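import Summits.CriticalPhenomena.PercolationContinuityZ3.Theorems.PercNearOneGluingNoHeavyLowerTailSahiE3DnfTwoSlot
import Summits.CriticalPhenomena.PercolationContinuityZ3.Theorems.PercNearOneGluingNoHeavyLowerTailSahiE3LroKahn
import Mathlib.Tactic.FinCases
import HarnessLib
import HarnessLib.Audit

/-!
# `NoHeavyLowerTail` (crux stmt-CriticalPhenomena-4575), Sahi programme P4: KAHN'S CONJECTURE 5 FOR THE FIRST SLOT
# `(x₁∧…∧x_a) ∨ (y₁∧…∧y_b)` — the `prodBernoulli` form

Support file (cell `prim-l12`, seat P4, generation 12; `--supports stmt-CriticalPhenomena-4575`).  No named facts, no sorries;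
standard axioms; def-free.

THEOREM `kahn_of_dnf_two`: for every finite index type `ι`, `p : ι → [0,1]`, distinct coordinates
`v : Fin (a+1) ⊕ Fin (b+1) → ι` with `0 < p (v i) < 1`, and ALL increasing events `A, B ⊆ Set ι`:
  `0 ≤ sahiE3 (prodBernoulli p) {ω | (∀ k, v (inl k) ∈ ω) ∨ (∀ k, v (inr k) ∈ ω)} A B`
— Kahn's Conjecture 5 [Kahn, arXiv:2210.08653, Conj. 5] when the first increasing event is "all of `v(inl ·)` open, or all of
`v(inr ·)` open", i.e. the union of two principal up-sets with disjoint finite supports (the other two events arbitrary).  Proof: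
`…SahiE3DnfTwoSlot.latticeE3_nonneg_of_dnf_two` on the Boolean lattice `Set ι` with the log-modular weight `bernoulliWeight p`
(pattern marginal = the product `∏ᵢ (pᵥᵢ | 1 − pᵥᵢ)`, `mass_bernoulliWeight_fibre'`) and the bridge `Literature…sahiE_three_ind`,
exactly as `…SahiE3LroKahn.kahn_of_lro`.  The interior condition `0 < p < 1` on the `a+b+2` pattern coordinates makes the explicit
certificate's normalisation `Δ′` positive; the boundary cases follow by continuity but are not recorded here.
-/

namespace Summit.CriticalPhenomena.PercolationContinuityZ3.Theorems.SahiE3DnfTwoKahn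

open Finset MeasureTheory Literature.Combinatorics.Sahi2008 Literature.Probability.Percolation
open Literature.Probability.LatticeModels (prodBernoulli sahiE3 mass latticeE3)

variable {ι : Type*} [Fintype ι]

/-- The `bernoulliWeight`-mass of a pattern fibre `{ω | ∀ i, v i ∈ ω ↔ t i}` is `∏ᵢ (p (v i) if t i else 1 − p (v i))`, for any
finite family of distinct coordinates (general index type; cf. `…SahiE3LroKahn.mass_bernoulliWeight_fibre`). [folklore] -/
theorem mass_bernoulliWeight_fibre' (p : ι → unitInterval) {σ : Type*} [Fintype σ] {v : σ → ι} (hv : Function.Injective v)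
    (F : Finset (Set ι)) (t : σ → Bool)
    (hF : ∀ x, x ∈ F ↔ ∀ i, (({v i} : Set ι) ≤ x ↔ t i = true)) :
    mass (bernoulliWeight p) F = ∏ i, (if t i = true then (p (v i) : ℝ) else 1 - (p (v i) : ℝ)) := by
  classical
  set T : Set ι := {e | ∃ i, v i = e ∧ t i = true} with hT
  have hFC : ∀ x, x ∈ F ↔ x ∈ localCylinder (↑(univ.image v) : Set ι) T := by
    intro x
    rw [hF]
    simp only [localCylinder, Set.mem_setOf_eq, Finset.coe_image, Finset.coe_univ, Set.image_univ, Set.mem_range,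
      forall_exists_index, forall_apply_eq_imp_iff, Set.singleton_subset_iff, hT]
    refine forall_congr' fun i => ?_
    have : (∃ i', v i' = v i ∧ t i' = true) ↔ t i = true :=
      ⟨fun ⟨i', hi', ht'⟩ => hv hi' ▸ ht', fun h => ⟨i, rfl, h⟩⟩
    rw [this]
  have e1 : mass (bernoulliWeight p) F = (prodBernoulli p).real (localCylinder (↑(univ.image v) : Set ι) T) := by
    rw [prodBernoulli_real_eq_sum_weight_ind]
    unfold mass
    rw [← Finset.sum_filter_add_sum_filter_not univ (fun x => x ∈ F)]
    have hz : ∑ x ∈ univ.filter (fun x => ¬ x ∈ F), bernoulliWeight p x *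
        DecisionTree.ind (localCylinder (↑(univ.image v) : Set ι) T) x = 0 :=
      Finset.sum_eq_zero fun x hx => by
        rw [DecisionTree.ind_of_not_mem (fun h => (Finset.mem_filter.1 hx).2 ((hFC x).2 h)), mul_zero]
    rw [hz, add_zero]
    have hf : univ.filter (fun x => x ∈ F) = F := by ext x; simp
    rw [hf]
    exact Finset.sum_congr rfl fun x hx => by rw [DecisionTree.ind_of_mem ((hFC x).1 hx), mul_one]
  rw [e1, prodBernoulli_real_localCylinder, Finset.prod_image fun a _ b _ h => hv h]
  refine Finset.prod_congr rfl fun i _ => ?_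
  have hm : v i ∈ T ↔ t i = true := ⟨fun ⟨i', hi', ht'⟩ => hv hi' ▸ ht', fun h => ⟨i, rfl, h⟩⟩
  by_cases h : t i = true
  · rw [if_pos (hm.2 h), if_pos h]
  · rw [if_neg (fun hh => h (hm.1 hh)), if_neg h]

open scoped Classical in
/-- **Kahn's Conjecture 5 for the first slot `(x₁∧…∧x_a) ∨ (y₁∧…∧y_b)`.**  `ι` finite, `p : ι → [0,1]`,
`v : Fin (a+1) ⊕ Fin (b+1) → ι` injective with `0 < p (v i) < 1`; then for ALL increasing `A, B ⊆ Set ι`: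
`0 ≤ sahiE3 (prodBernoulli p) {ω | (∀ k, v (inl k) ∈ ω) ∨ (∀ k, v (inr k) ∈ ω)} A B`. [this work] -/
theorem kahn_of_dnf_two (p : ι → unitInterval) (a b : ℕ) {v : Fin (a + 1) ⊕ Fin (b + 1) → ι}
    (hv : Function.Injective v) (hp : ∀ i, 0 < (p (v i) : ℝ) ∧ (p (v i) : ℝ) < 1)
    {A B : Set (Set ι)} (hA : IsUpperSet A) (hB : IsUpperSet B) :
    0 ≤ sahiE3 (prodBernoulli p) {ω : Set ι | (∀ k, v (Sum.inl k) ∈ ω) ∨ (∀ k, v (Sum.inr k) ∈ ω)} A B := by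
  rw [← sahiE_three_ind]
  have hμ := isFKGMeasure_bernoulliWeight p
  have hA' : IsUpperSet ((A.toFinset : Finset (Set ι)) : Set (Set ι)) := by simpa using hA
  have hB' : IsUpperSet ((B.toFinset : Finset (Set ι)) : Set (Set ι)) := by simpa using hB
  have hF : ∀ (t : Fin (a + 1) ⊕ Fin (b + 1) → Bool) (x : Set ι),
      x ∈ (univ.filter fun x : Set ι => ∀ i, (({v i} : Set ι) ≤ x ↔ t i = true)) ↔
        ∀ i, (({v i} : Set ι) ≤ x ↔ t i = true) := fun t x => by simp
  have hw : ∀ (i : Fin (a + 1) ⊕ Fin (b + 1)) (c : Bool),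
      0 < (if c = true then (p (v i) : ℝ) else 1 - (p (v i) : ℝ)) := by
    intro i c
    split_ifs
    · exact (hp i).1
    · exact sub_pos.2 (hp i).2
  obtain ⟨U', hU'⟩ : ∃ V : Finset (Fin (a + 1) ⊕ Fin (b + 1) → Bool),
      ∀ t, t ∈ V ↔ ((∀ k, t (Sum.inl k) = true) ∨ (∀ k, t (Sum.inr k) = true)) :=
    ⟨univ.filter fun t => (∀ k, t (Sum.inl k) = true) ∨ (∀ k, t (Sum.inr k) = true), fun t => by simp⟩
  have key := SahiE3DnfTwoSlot.latticeE3_nonneg_of_dnf_two hμ.nonneg hμ.mul_le_mul a b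
    (fun i => SahiE3MajSlot.supPrime_set_singleton (v i)) hF hA' hB'
    (fun i c => if c = true then (p (v i) : ℝ) else 1 - (p (v i) : ℝ)) hw
    (fun t => mass_bernoulliWeight_fibre' p hv _ t (hF t)) U' hU'
  rw [← sahiE_three_indicator_eq_latticeE3 hμ.sum_eq_one] at key
  refine le_of_le_of_eq key ?_
  congr 1
  funext i
  fin_cases i
  · funext ω
    simp [setInd_apply, DecisionTree.ind, Set.singleton_subset_iff, hU']
  · funext ω
    simp [setInd_apply, DecisionTree.ind]
  · funext ω
    simp [setInd_apply, DecisionTree.ind]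

end Summit.CriticalPhenomena.PercolationContinuityZ3.Theorems.SahiE3DnfTwoKahn
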